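import Summits.QuantumFields.YangMills.Theorems.UnitScaleTiltHalvingP1FlatCorePreGauge
import HarnessLib

/-!
# Route `UnitScaleTilt`, crux K1 child «MinimiserStabilityRegPr» (stmt-QuantumFields-19200), stub `stub_halvingStep` (H) — pillar P1♭ `core`, LEAD-H T2♭-PLAN v1.1
# junction J3 (HYPOTHESES♭), companion of ✓`…HalvingP1FlatCorePreGauge`: **THE FLAT PRE-GAUGE WITH ITS THREE WINDOWS DISCHARGED** from the cell's standing smallness
# `10⁷L³ε₀ ≤ 1` ([Balaban1985Averaging] Prop. 2's `C₀α ≤ ⅓`, `2α ≤ c₂′` at `α = 2ε₀`, `d = 3`, `L ≥ 3`; and the (1.65)-descent window `11d²α + α₁ ≤ 1∕6`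
# for a top box of `l1`-perimeter `≤ 10⁵`).

Cell `ym3-torus`, width seat `ym-ust-20520-w5` (gen 5).  `--supports stmt-QuantumFields-19200 --as helper`; THEOREMS ONLY (0 `def`, 0 `sorry`); count-neutral; nothing
here claims the stub, the crux, d = 4 or the mass gap — YM₃ on T³ is a ladder rung (R3), not the Clay problem.

WHAT IS PROVED: `preGauge_windows` (the three numerals of ✓`P1FlatCorePreGauge.exists_preGauge_flat` from `10⁷L³ε₀ ≤ 1`, `L ≥ 3` odd, `l1(hi − lo) ≤ 10⁵`:
`C₀ = 11339776`, `c₂′ = 1∕(14336L²)`) and ★★★`exists_preGauge_flat_of_ten7` — ✓`exists_preGauge_flat` with `hε3 hε2 hsmall` replaced by those two standing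
hypotheses, every conclusion VERBATIM (so J4c∕J5 carry no Prop.-2 numerals).

References: T. Bałaban, CMP **98** (1985) 17–51 [Balaban1985Averaging] (Prop. 2 (52)–(54) p.26); CMP **99** (1985) 75–102 [Balaban1985RegularSpaces]
((1.33)–(1.35) p.82, (1.65)–(1.66) p.87, Thm 4 p.88); CMP **102** (1985) 277–309 [Balaban1985Variational] ((2) p.278, (152) p.301).
-/

set_option autoImplicit false

noncomputable section

namespace Summit.QuantumFields.YangMills.Theorems.P1FlatCorePreGauge

open Literature.MathematicalPhysics.QuantumFieldTheory.Balaban1983to89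
open Literature.MathematicalPhysics.QuantumFieldTheory.Balaban1983to89.T3ContinuumYM3Torus
open Literature.MathematicalPhysics.QuantumFieldTheory.Balaban1983to89.T3PrintedRegularMinimiser (RegPr)
open B7Prop1Explicit renaming Site → LSite
open B7Prop1Explicit (gaugeAct axialFn boxVec e l1)
open B7Prop2Explicit (avgIter C0 c2')
open B7Prop2SpecialUnitary (specialUnitaryUnits)
open B8Ineq130 (tlo thi)
open B8Ineq132 (InAk)
open B8Eq119TwistedAxial (InAx)
open B8Lemma1NonAbelian (lowPart)
open B10Eq27TorusAxialLog (pull unitsField toUField)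
open B8Thm2SetupTorus (pullGauge toUGauge)

section Windows

open scoped Matrix.Norms.L2Operator

variable (F : T3Family) {n K : ℕ}

/-- **THE THREE WINDOWS OF `exists_preGauge_flat` FROM THE CELL'S STANDING SMALLNESS `10⁷L³ε₀ ≤ 1`** (`L ≥ 3` odd, `d = 3`: `C₀ = 226·(8·4·7)² = 11339776`,
`c₂′ = 1∕(14336L²)`) and a top box of `l1`-perimeter at most `10⁵`: `C₀·(2ε₀) ≤ ⅓`, `2(2ε₀) ≤ c₂′`, `11d²(2ε₀) + B·(4ε₀) ≤ 1∕6`.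
[cite: Balaban1985Averaging, Prop. 2 (52)-(54) p.26; Balaban1985RegularSpaces, (1.65)-(1.66) p.87] -/
theorem preGauge_windows {ε₀ : ℝ} (hε₀ : 0 ≤ ε₀) (hε : 10 ^ 7 * (F.L : ℝ) ^ 3 * ε₀ ≤ 1) {B : ℝ} (hB : B ≤ 10 ^ 5) :
    C0 (F.P K).d * (2 * ε₀) ≤ 1 / 3 ∧ 2 * (2 * ε₀) ≤ c2' (F.P K).d (F.P K).L ∧
      11 * ((F.P K).d : ℝ) ^ 2 * (2 * ε₀) + B * (2 * (2 * ε₀)) ≤ 1 / 6 := by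
  have hL : (3 : ℝ) ≤ F.L := by
    have h3 : 3 ≤ F.L := by
      obtain ⟨⟨t, ht⟩, h1⟩ := F.hL
      omega
    exact_mod_cast h3
  show C0 3 * (2 * ε₀) ≤ 1 / 3 ∧ 2 * (2 * ε₀) ≤ c2' 3 F.L ∧ 11 * ((3 : ℕ) : ℝ) ^ 2 * (2 * ε₀) + B * (2 * (2 * ε₀)) ≤ 1 / 6
  have hL3 : (27 : ℝ) ≤ (F.L : ℝ) ^ 3 := by
    have h := pow_le_pow_left₀ (by norm_num : (0 : ℝ) ≤ 3) hL 3
    norm_num at h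
    exact h
  have hεb : 27 * (10 ^ 7 * ε₀) ≤ 1 :=
    le_trans (by nlinarith [mul_le_mul_of_nonneg_right hL3 (by positivity : (0 : ℝ) ≤ 10 ^ 7 * ε₀)]) hε
  have h2 : 3 * (10 ^ 7 * (F.L : ℝ) ^ 2 * ε₀) ≤ 1 :=
    calc 3 * (10 ^ 7 * (F.L : ℝ) ^ 2 * ε₀) ≤ (F.L : ℝ) * (10 ^ 7 * (F.L : ℝ) ^ 2 * ε₀) :=
          mul_le_mul_of_nonneg_right hL (by positivity)
      _ = 10 ^ 7 * (F.L : ℝ) ^ 3 * ε₀ := by ring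
      _ ≤ 1 := hε
  refine ⟨?_, ?_, ?_⟩
  · have hC : C0 3 = 11339776 := by simp only [C0]; norm_num
    rw [hC]
    linarith
  · have hc : c2' 3 F.L = 1 / (14336 * (F.L : ℝ) ^ 2) := by simp only [c2']; norm_num
    have hL2 : (0 : ℝ) < 14336 * (F.L : ℝ) ^ 2 := by positivity
    rw [hc, le_div_iff₀ hL2]
    nlinarith [h2]
  · have hBε : B * (2 * (2 * ε₀)) ≤ 10 ^ 5 * (2 * (2 * ε₀)) := mul_le_mul_of_nonneg_right hB (by positivity)
    push_cast
    nlinarith [hBε, hεb, hε₀]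

/-- ★★★ **`exists_preGauge_flat` WITH ITS THREE WINDOWS DISCHARGED** from the standing smallness `10⁷L³ε₀ ≤ 1` and a top box of `l1`-perimeter `≤ 10⁵` (every conclusion
VERBATIM; the (d)-bound reads `22d²ε₀ + 4·l1(hi − lo)·ε₀` as before). [cite: Balaban1985RegularSpaces, (1.33)-(1.35) p.82, (1.65)-(1.66) p.87, Thm 4 p.88; Balaban1985Variational, (2) p.278, (152) p.301] -/
theorem exists_preGauge_flat_of_ten7 (hnK : n < K) {ε₀ : ℝ} (hε₀ : 0 < ε₀) (hε : 10 ^ 7 * (F.L : ℝ) ^ 3 * ε₀ ≤ 1)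
    {U : GaugeField (F.P K) 0 (Matrix.specialUnitaryGroup (Fin 2) ℂ)} (hU : RegPr F n K ε₀ U)
    (lo hi : LSite (F.P K).d) (hwrap : ∀ i, hi i - lo i < ((F.P K).sitesPerDir (K - n) : ℤ)) (hbox : (l1 (hi - lo) : ℝ) ≤ 10 ^ 5)
    (c₀ : (Matrix (Fin 2) (Fin 2) ℂ)ˣ) (hc₀ : c₀ ∈ specialUnitaryUnits (Fin 2)) :
    ∃ g : GaugeTransf (F.P K) 0 (Matrix.specialUnitaryGroup (Fin 2) ℂ),
      InAk (F.P K).L (K - n) (((F.L : ℝ)⁻¹) ^ (K - n)) ε₀ (fun _ => (Set.univ : Set (LSite (F.P K).d)))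
        (pull (unitsField (toUField (GaugeField.gaugeAct g U))) 0) ∧
      (∀ z : LSite (F.P K).d, lo ≤ z → z ≤ hi →
        pullGauge (fun x => Unitary.toUnits (toUGauge (F.P K) 2 g x)) 0 ((((F.P K).L : ℤ) ^ (K - n)) • z) =
          c₀ * axialFn (avgIter (F.P K).L (pull (unitsField (toUField U)) 0) (K - n)) lo z) ∧
      (∀ m, m < K - n → ∀ (z : LSite (F.P K).d) (r : Fin (F.P K).d → Fin (F.P K).L),
        axialFn (avgIter (F.P K).L (pull (unitsField (toUField (GaugeField.gaugeAct g U))) 0) (K - n - (m + 1)))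
          (((F.P K).L : ℤ) • z) (((F.P K).L : ℤ) • z + boxVec (F.P K).L r) = 1) ∧
      (∀ m, m ≤ K - n → ∀ Λ : ℕ → Set (LSite (F.P K).d),
        InAx (F.P K).L m Λ (1 : LSite (F.P K).d → Fin (F.P K).d → (Matrix (Fin 2) (Fin 2) ℂ)ˣ) (pull (unitsField (toUField (GaugeField.gaugeAct g U))) 0)) ∧
      (∀ (x : LSite (F.P K).d) (ν : Fin (F.P K).d), lo ≤ x → x + e ν ≤ hi → lowPart ν (x - lo) = 0 →
        avgIter (F.P K).L (pull (unitsField (toUField (GaugeField.gaugeAct g U))) 0) (K - n) x ν = 1) ∧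
      (∀ (x : LSite (F.P K).d) (ν : Fin (F.P K).d), lo ≤ x → x + e ν ≤ hi →
        ‖((avgIter (F.P K).L (pull (unitsField (toUField (GaugeField.gaugeAct g U))) 0) (K - n) x ν : (Matrix (Fin 2) (Fin 2) ℂ)ˣ) :
            Matrix (Fin 2) (Fin 2) ℂ) - 1‖ ≤ l1 (hi - lo) * (2 * (2 * ε₀))) ∧
      (∀ m, m ≤ K - n → ∀ (x : LSite (F.P K).d) (ν : Fin (F.P K).d), tlo (F.P K).L lo m ≤ x → x + e ν ≤ thi (F.P K).L hi m →
        ‖((avgIter (F.P K).L (pull (unitsField (toUField (GaugeField.gaugeAct g U))) 0) (K - n - m) x ν : (Matrix (Fin 2) (Fin 2) ℂ)ˣ) :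
            Matrix (Fin 2) (Fin 2) ℂ) - 1‖ < 11 * ((F.P K).d : ℝ) ^ 2 * (2 * ε₀) + l1 (hi - lo) * (2 * (2 * ε₀))) := by
  obtain ⟨h3, h2, hs⟩ := preGauge_windows F (K := K) hε₀.le hε hbox
  exact exists_preGauge_flat F hnK hε₀ h3 h2 hU lo hi hwrap hs c₀ hc₀

end Windows

end Summit.QuantumFields.YangMills.Theorems.P1FlatCorePreGauge

end
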